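import Summits.HodgeConjecture.CorCM.Census.CentralSquaresDihedralLaw
import Summits.HodgeConjecture.CorCM.Census.DihedralInstance
import Summits.HodgeConjecture.CorCM.Census.GroupIsoTransport

/-!
# The square-central class, XLVI: THE DIHEDRAL LAW, UNIFORM — every surjection of a finite `2`-group onto `D₄` carrying `c` to `r²`

COR-CM (cell `pub-hodgecm2`), count-neutral kernel combinatorics by the binder seat b09 (gen 48; lane SQUARE-CENTRAL CLASS, part XLVI), on part XLV
(`isLeast_card_gfaces_generate_of_dihedral`, `|ker π| ≥ 2`), seat b23ʼs dihedral law for `DihedralGroup (2n)` itself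
(`Dihedral.isLeast_card_gfaces_generate_dihedralGroup_fibreTwo`, here `n = 2`: `D₄` with `c = r²`, the case `|ker π| = 1`) and seat b23ʼs census
invariance under group isomorphism (`GroupIso.isLeast_map`, `GroupIso.fibreTwo_eq`) BY NAME.  Theorems only: no definition, no certificate, no named fact,
no `sorry`; `decide` only on `DihedralGroup 4`.  HONEST FRAMING: `HC_CM` is NOT proved, here or anywhere in the tree; nothing here is a period or a
headline — these are census laws `μ(G, c)` for the face-relation lattice.

**`isLeast_card_gfaces_generate_of_surjective_dihedral`**: `G` a finite `2`-group, `c` a central involution, `π : G →* D₄` surjective with `π c = r²`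
⟹ **`μ(G, c) = φ₂(G, c)`** — no hypothesis on the kernel at all; `…_block`: **`= β(G, c) − 2`**.

## References
* [Pohlmann1968] H. Pohlmann, Algebraic cycles on abelian varieties of complex multiplication type, Ann. of Math. 88 (1968), Thm 1.
-/

namespace Summit.HodgeConjecture.CorCM.Census.CentralSquares

open Finset DihedralGroup
open Summit.HodgeConjecture.CorCM.Prior.AllgGroup.RfwfAllgGroup
open Summit.HodgeConjecture.CorCM.Census.BlockParity
open Summit.HodgeConjecture.CorCM.Census.Coinvariant
open Summit.HodgeConjecture.CorCM.Census.BaseBlock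

noncomputable section

variable {G : Type*} [Group G] [Fintype G] [DecidableEq G]

/-- **THE DIHEDRAL LAW, UNIFORM.**  `G` a finite `2`-group, `c` a central involution, `π : G →* D₄` surjective with `π c = r²`:
**`μ(G, c) = φ₂(G, c)`** — for a nontrivial kernel this is part XLV; for a trivial kernel `π` is an isomorphism with `D₄` carrying `c` to `r²`, and
seat b23ʼs dihedral law for `D₄` transports along it. [folklore] -/
theorem isLeast_card_gfaces_generate_of_surjective_dihedral {c : G} (hG : IsPGroup 2 G) (hc2 : c * c = 1) (hcen : ∀ x : G, x * c = c * x)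
    (π : G →* DihedralGroup 4) (hπ : Function.Surjective π) (hπc : π c = r 2) :
    IsLeast {n : ℕ | ∃ S : Finset (CMF G c →₀ ℤ), (↑S ⊆ gfaceSet G c hc2) ∧ S.card = n ∧
      hodgeSpan c hc2 ≤ Submodule.span ℤ (pairSet c) ⊔ Submodule.span ℤ (translates c S)} (fibreTwo c hc2) := by
  classical
  by_cases hker : 2 ≤ Nat.card π.ker
  · exact isLeast_card_gfaces_generate_of_dihedral hG hc2 hcen π hπ hπc hker
  · -- trivial kernel: `π` is an isomorphism
    have hk1 : Nat.card π.ker = 1 := by have := Nat.card_pos (α := π.ker); omega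
    have hbot : π.ker = ⊥ := Subgroup.eq_bot_of_card_eq π.ker hk1
    have hinj : Function.Injective π := (MonoidHom.ker_eq_bot_iff π).mp hbot
    let e : DihedralGroup (2 * 2) ≃* G := (MulEquiv.ofBijective π ⟨hinj, hπ⟩).symm
    have hc2' : (r ((2 : ℕ) : ZMod (2 * 2)) : DihedralGroup (2 * 2)) * r ((2 : ℕ) : ZMod (2 * 2)) = 1 := by decide
    have hc : e (r ((2 : ℕ) : ZMod (2 * 2))) = c := by
      have h1 : (MulEquiv.ofBijective π ⟨hinj, hπ⟩) c = r ((2 : ℕ) : ZMod (2 * 2)) := by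
        rw [MulEquiv.ofBijective_apply, hπc]; decide
      rw [← h1]; exact MulEquiv.symm_apply_apply _ c
    have hm := GroupIso.isLeast_map e hc hc2' hc2 (Dihedral.isLeast_card_gfaces_generate_dihedralGroup_fibreTwo (n := 2) hc2')
    rwa [GroupIso.fibreTwo_eq e hc hc2' hc2] at hm

/-- **THE DIHEDRAL LAW, UNIFORM, BLOCK FORM: `μ(G, c) = β(G, c) − 2`** for every surjection of a finite `2`-group onto `D₄` carrying `c` to `r²`.
[folklore] -/
theorem isLeast_card_gfaces_generate_of_surjective_dihedral_block {c : G} (hG : IsPGroup 2 G) (hc2 : c * c = 1)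
    (hcen : ∀ x : G, x * c = c * x) (π : G →* DihedralGroup 4) (hπ : Function.Surjective π) (hπc : π c = r 2) :
    IsLeast {n : ℕ | ∃ S : Finset (CMF G c →₀ ℤ), (↑S ⊆ gfaceSet G c hc2) ∧ S.card = n ∧
      hodgeSpan c hc2 ≤ Submodule.span ℤ (pairSet c) ⊔ Submodule.span ℤ (translates c S)} (Fintype.card (Block c) - 2) := by
  have h := fibreTwo_add_two_eq_card_block_of_dihedral_quotient' hG hc2 hcen π hπ hπc
  rw [show Fintype.card (Block c) - 2 = fibreTwo c hc2 by omega]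
  exact isLeast_card_gfaces_generate_of_surjective_dihedral hG hc2 hcen π hπ hπc

end

end Summit.HodgeConjecture.CorCM.Census.CentralSquares
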